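import Literature.Computability.MetaComplexity.LanguageCompressionAssembly
import Literature.Computability.MetaComplexity.SliceEstimator
import HarnessLib

/-!
# Complexity meta: Hirahara 2021, Theorem 4.2 relative to Lemma 3.4 and the `K`-form of Theorem 3.12

Topic `Literature/Computability/MetaComplexity`, head of the inline proof plan of the named fact
`Hirahara2021_languageCompression` (S. Hirahara, *Average-case hardness of NP from exponential
worst-case hardness assumptions*, ECCC TR21-058 / STOC 2021, Theorem 4.2): the assembly
`LCAssembly.Hirahara2021_languageCompression_of_lemmas` (`LanguageCompressionAssembly.lean`) with its
Lemma-4.5 hypothesis DISCHARGED by `SLB.exists_logSizeEstimator` (`SliceEstimator.lean`, the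
Goldwasser–Sipser lower bound protocol for the slices run through the one-sided heuristic of Lemma 3.6
and `pr-BPP = pr-P`). What remains hypothetical is exactly the two results of the paper's §3 that are
separate theorems with their own proofs:

* `h34` — **Lemma 3.4** in promise form: the hypothesis `coNP × {U, T} ⊆ Avg¹_{1-n^{-c}}P` gives
  `pr-BPP = pr-P` (via the pseudorandom generator of [BFP05] + [KS04]/[IW97]);
* `h312K` — **Theorem 3.12** in its `K^t` form (the direct-product reconstruction with
  time-bounded-Kolmogorov conclusion).

Hence `Hirahara2021_languageCompression_of h34 h312K : Hirahara2021_languageCompression`.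

## References

* S. Hirahara, ECCC TR21-058 (2021), Thm. 4.2, Lemma 3.4, Thm. 3.12, Lemma 4.5 [Hirahara2021].
-/

namespace Literature.Computability.MetaComplexity

open _root_.Computability Polynomial Complexity Complexity.Classes Complexity.Nondeterministic

/-- **Hirahara 2021, Theorem 4.2, relative to Lemma 3.4 (promise form) and Theorem 3.12 (`K`-form).**
Everything else in the printed proof — Lemma 3.6 (generator-free), Lemma 4.5 with Lemma 4.6
(Goldwasser–Sipser), `L' ∈ NP` and Eq. (6), the test `B'`, Claim 4.7, the final bounds and the
finite patching — is proved in the tree (`ParamUniform*`, `SliceLowerBound*`, `SliceEstimator*`,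
`LanguageCompression{NP,Test,Bounds,Claim,Assembly}.lean`). [cite: Hirahara2021, Theorem 4.2 (proof, pp. 26–29)] -/
theorem Hirahara2021_languageCompression_of
    (h34 : (∃ c : ℕ, distClass coNP {uniformEnsemble, tallyEnsemble} ⊆
        Avg1DeltaP fun n => 1 - 1 / (n : ℝ) ^ c) → PromiseBPP' ⊆ PromiseP)
    (h312K : ∀ U : UniversalMachine,
      (∃ c : ℕ, distClass coNP {uniformEnsemble, tallyEnsemble} ⊆ Avg1DeltaP fun n => 1 - 1 / (n : ℝ) ^ c) →
        ∀ D₀ : Language Bool, D₀ ∈ Classes.P → ∃ q : Polynomial ℕ,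
          ∀ (x : List Bool) (m k e : ℕ), 1 ≤ e →
            1 / (e : ℝ) ≤ dpAdvantage k x (fun w => D₀.boolIndicator (paramEnc (w, m))) →
              U.ktAt (q.eval (x.length + k + e + m)) x ≤
                ((k + Nat.log 2 (q.eval (x.length + k + e + m)) : ℕ) : ℕ∞)) :
    Hirahara2021_languageCompression :=
  LCAssembly.Hirahara2021_languageCompression_of_lemmas h34 h312K fun hyp _ hL hens =>
    SLB.exists_logSizeEstimator hyp (h34 hyp) hL hens

end Literature.Computability.MetaComplexity
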